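import Literature.AlgebraicGeometry.Frobenioids.ArchimedeanFSM
import Literature.AlgebraicGeometry.Frobenioids.ArchimedeanHalfCircleLiftsDeg
import HarnessLib

/-!
# Frobenioids II, Proposition 3.4 (iii): the COUNTEREXAMPLE over `D := D₀`, angular Frobenioid `A`
# (abc-iut cell, layer L1, node `FrdII:Prop3.4(iii)`, chain LC-L1-2 — refutation, `F = A`)

Mochizuki, *The geometry of Frobenioids II: poly-Frobenioids*, Kyushu J. Math. **62** (2008)
401–460, §3, Proposition 3.4 (iii) p. 30 ("FSM-morphisms of `F` project to FSM-morphisms of `D`",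
`F ∈ {A, N, R}`), proof p. 31. [cite: MochizukiFrdII2008, Prop 3.4 (iii) p.30]

PROVED here (proof-only, nothing defined): the `A`-conjunct of the typed item is FALSE at
`π = 𝟭 D₀`: `towerA_id_not_propIII : ¬ (towerA (𝟭 D0)).PropIII`. Same witness as for `N`
(`ArchimedeanFSMCounterexample.lean`): `X = (Spec ℂ, right half-circle, tip 1)`, `Y` the real unit,
`φ = ((Spec ℂ → Spec ℝ, 1, i), Spec ℂ → Spec ℝ)`, now read in the angular Frobenioid `A` (all
isometries, arbitrary Frobenius degree). Monomorphism: as for `N` (`C0.no_conj_pair_of_re_pos`, any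
degree). Fiberwise-surjectivity against a test arrow `γ` of degree `d`: real test objects through
`δ₁ = (id, d, 1)`, `δ₂ = (Spec ℂ → Spec ℝ, 1, (i/c_γ)^{1/d})` (`C0.exists_lift_pair_real`); complex test
objects through `δ₁ = (τ, d, τ(i)⁻¹ c_γ z₁^d)`, `δ₂ = (id, 1, z₁)` with `Im(c_γ z₁^d/|c_γ|) ≠ 0`
(`exists_mem_im_pow_ne_zero`, `C0.exists_lift_pair_deg`). The projection `Spec ℂ → Spec ℝ` is not a
monomorphism of `D₀`. No side is taken on [IUTchIII] Cor. 3.12.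
-/

namespace Literature.AlgebraicGeometry.Frobenioids

open CategoryTheory Set
open scoped Pointwise

noncomputable section

namespace ArchFrd

/-- **Prop. 3.4 (iii) fails for `F = A` over `D = D₀`**: the isometry
`φ = ((Spec ℂ → Spec ℝ, 1, i), Spec ℂ → Spec ℝ)` from the right-half-circle object to the real unit is
an FSM-morphism of `A` whose projection `Spec ℂ → Spec ℝ` is not a monomorphism of `D₀`.
[cite: MochizukiFrdII2008, Prop 3.4 (iii) p.30] -/
theorem towerA_id_not_propIII : ¬ (towerA (𝟭 D0)).PropIII := by
  intro hIII
  have hπ2 : (0 : ℝ) < Real.pi / 2 := by linarith [Real.pi_pos]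
  have hπ2' : Real.pi / 2 < Real.pi := by linarith [Real.pi_pos]
  let RX : AngularRegion ℂ := arcRegion 1 (Real.pi / 2) hπ2 hπ2' 1
  have hRX : D0.complex = D0.real → RX.IsIsotropic := fun h => nomatch h
  have hRXd : RX.dir = arcDir 1 (Real.pi / 2) := rfl
  have hRXt : RX.tip = 1 := rfl
  let X0 : C0 := ⟨D0.complex, RX, hRX⟩
  let Iu : ℂˣ := Units.mk0 Complex.I Complex.I_ne_zero
  have hsub : ∀ (K : D0) (f g : K ⟶ D0.real), f = g := fun K f g => Subsingleton.elim f g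
  -- the arrow φ₀ = (Spec ℂ → Spec ℝ, 1, i)
  have hmaps : Iu • X0.region.carrier ^ ((1 : ℕ+) : ℕ) ⊆ C0.pullRegion (C0.realOfTip 1) D0.toRealHom := by
    rw [PNat.one_coe, pow_one]
    rintro _ ⟨x, hx, rfl⟩
    show Iu • x ∈ D0.toRealHom.act '' (AngularRegion.isotropicOfTip (K := ℂ) 1).carrier
    unfold D0.Hom.act
    rw [D0.twists_toRealHom, D0.image_galAct_false,
      C0.mem_carrier_of_isIsotropic (AngularRegion.isIsotropic_isotropicOfTip 1), absHom_le_iff,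
      smul_eq_mul, Units.val_mul, norm_mul]
    show ‖Complex.I‖ * ‖(x : ℂ)‖ ≤ ((1 : PosReal) : ℝ)
    rw [Complex.norm_I, one_mul]
    exact (absHom_le_iff x RX.tip).mp hx.2
  have hmem : Iu ∈ D0.scalars X0.base := by
    show _ ∈ D0.scalars D0.complex
    rw [D0.scalars_complex]
    exact Subgroup.mem_top _
  let φ0 : X0 ⟶ C0.realOfTip 1 := ⟨D0.toRealHom, 1, Iu, hmem, hmaps⟩
  have hφI : PreFrobenioid.IsIsometry C0.toElem φ0 := by
    rw [A0.isIsometry_iff_norm_mul_tip_pow]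
    show ‖Complex.I‖ * ((1 : PosReal) : ℝ) ^ ((1 : ℕ+) : ℕ) = ((1 : PosReal) : ℝ)
    rw [Complex.norm_I, one_mul, PNat.one_coe, pow_one]
  -- the objects and the arrow of `A`
  let X : A (𝟭 D0) := ⟨⟨X0, D0.complex, Iso.refl _⟩⟩
  let Y : A (𝟭 D0) := ⟨⟨C0.realOfTip 1, D0.real, Iso.refl _⟩⟩
  let φC : X.obj ⟶ Y.obj := ⟨φ0, D0.toRealHom, hsub _ _ _⟩
  have hφiso : PreFrobenioid.isometricMorphisms (C.toElem (𝟭 D0)) φC := hφI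
  let φ : X ⟶ Y := ⟨φC, hφiso⟩
  -- φ is a monomorphism of A
  have hmono : Mono φ := by
    refine ⟨fun {V} a b hab => ?_⟩
    have hC : a.hom.fst ≫ φ0 = b.hom.fst ≫ φ0 := congrArg (fun f => f.hom.fst) hab
    by_cases ht : D0.Hom.twists (C0.Base a.hom.fst) = D0.Hom.twists (C0.Base b.hom.fst)
    · have hbase : C0.Base a.hom.fst = C0.Base b.hom.fst := D0.hom_eq_of_twists_eq _ _ ht
      have hdeg : C0.degFr a.hom.fst = C0.degFr b.hom.fst := by
        have h := congrArg C0.degFr hC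
        rw [C0.degFr_comp', C0.degFr_comp'] at h
        change C0.degFr _ * 1 = C0.degFr _ * 1 at h
        rwa [mul_one, mul_one] at h
      have hsc := congrArg C0.scalar hC
      rw [C0.scalar_comp', C0.scalar_comp', hbase] at hsc
      have hscal : C0.scalar a.hom.fst = C0.scalar b.hom.fst := by
        have h' : C0.scalar a.hom.fst ^ ((1 : ℕ+) : ℕ) = C0.scalar b.hom.fst ^ ((1 : ℕ+) : ℕ) :=
          mul_left_cancel hsc
        rwa [PNat.one_coe, pow_one, pow_one] at h'
      have h0 : a.hom.fst = b.hom.fst := C0.hom_ext hbase hdeg hscal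
      have hD : a.hom.snd = b.hom.snd := by
        have wa := a.hom.w
        have wb := b.hom.w
        rw [h0] at wa
        exact (cancel_epi V.obj.iso.hom).mp (wa.symm.trans wb)
      apply WideSubcategory.hom_ext _
      exact CFP.hom_ext h0 hD
    · exact (C0.no_conj_pair_of_re_pos (X := X0) hRXd φ0 rfl rfl _ _ hC ht).elim
  -- φ is fiberwise-surjective in A
  have hfs : IsFiberwiseSurjective φ := by
    intro W γ
    obtain ⟨⟨⟨KW, RW, hRW⟩, WD, ιW⟩⟩ := W
    obtain ⟨⟨γ0, γD, wγ⟩, hγiso⟩ := γ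
    have hγI : PreFrobenioid.IsIsometry C0.toElem γ0 := hγiso
    cases KW with
    | real =>
      obtain ⟨RV, hRV, δ₁0, δ₂0, hb₁, hI₁, hI₂, hcomp⟩ :=
        C0.exists_lift_pair_real hRW γ0 hγI hRX hRXd hRXt φ0 rfl rfl
      let V : A (𝟭 D0) := ⟨⟨⟨D0.complex, RV, hRV⟩, D0.complex, Iso.refl _⟩⟩
      have hb₁' : (PreFrobenioid.baseFunctor C0.toElem).map δ₁0 = 𝟙 D0.complex := hb₁
      have hb₂' : (PreFrobenioid.baseFunctor C0.toElem).map δ₂0 = D0.toRealHom :=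
        D0.hom_to_real_eq rfl _ _
      have w₁ : (PreFrobenioid.baseFunctor C0.toElem).map δ₁0 ≫ X.obj.iso.hom =
          V.obj.iso.hom ≫ (𝟭 D0).map (𝟙 D0.complex) := by
        rw [hb₁']
        rfl
      have w₂ : (PreFrobenioid.baseFunctor C0.toElem).map δ₂0 ≫ ιW.hom =
          V.obj.iso.hom ≫ (𝟭 D0).map (D0.toRealHom ≫ ιW.hom) := by
        rw [hb₂']
        exact (Category.id_comp _).symm
      let δ₁C : V.obj ⟶ X.obj := ⟨δ₁0, 𝟙 D0.complex, w₁⟩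
      let δ₂C : V.obj ⟶ ⟨⟨D0.real, RW, hRW⟩, WD, ιW⟩ := ⟨δ₂0, D0.toRealHom ≫ ιW.hom, w₂⟩
      have hδ₁iso : PreFrobenioid.isometricMorphisms (C.toElem (𝟭 D0)) δ₁C := hI₁
      have hδ₂iso : PreFrobenioid.isometricMorphisms (C.toElem (𝟭 D0)) δ₂C := hI₂
      refine ⟨V, ⟨δ₁C, hδ₁iso⟩, ⟨δ₂C, hδ₂iso⟩, ?_⟩
      apply WideSubcategory.hom_ext _
      exact CFP.hom_ext hcomp (hsub _ _ _)
    | complex =>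
      -- a point z₁ of the angular part of W with Im (c_γ z₁^d / |c_γ|) ≠ 0
      obtain ⟨z₁, hz₁, hz₁i⟩ := exists_mem_im_pow_ne_zero RW.isOpen_dir
        (let ⟨z, hz, _⟩ := (RW.isConnected_inter 1).nonempty; ⟨z, hz⟩) (unitPart ℂ (C0.scalar γ0))
        (C0.degFr γ0).pos
      have hcγ : ((C0.scalar γ0 : ℂˣ) : ℂ) =
          (‖((C0.scalar γ0 : ℂˣ) : ℂ)‖ : ℂ) * (((unitPart ℂ (C0.scalar γ0) : ℂˣ)) : ℂ) := by
        have := congrArg (fun u : ℂˣ => (u : ℂ)) (unitPart_mul_ofPosReal_absHom (K := ℂ) (C0.scalar γ0))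
        simp only [Units.val_mul, coe_ofPosReal, coe_absHom] at this
        rw [mul_comm]
        exact this.symm
      have hcpos : 0 < ‖((C0.scalar γ0 : ℂˣ) : ℂ)‖ := norm_pos_iff.mpr (C0.scalar γ0).ne_zero
      set r : ℂ := (((unitPart ℂ (C0.scalar γ0) * z₁ ^ (C0.degFr γ0 : ℕ) : ↥(normOneSubgroup ℂ)) :
        ℂˣ) : ℂ) with hr
      have hprod : ∀ σ : Bool,
          ((((D0.galAct σ Iu)⁻¹ * C0.scalar γ0 * (z₁ : ℂˣ) ^ (C0.degFr γ0 : ℕ) : ℂˣ) : ℂ)) =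
            (‖((C0.scalar γ0 : ℂˣ) : ℂ)‖ : ℂ) * ((((D0.galAct σ Iu : ℂˣ) : ℂ))⁻¹ * r) := by
        intro σ
        conv_lhs => rw [Units.val_mul, Units.val_mul, Units.val_inv_eq_inv_val, hcγ]
        rw [hr]
        push_cast
        ring
      have hval : ∀ σ : Bool, (((D0.galAct σ Iu : ℂˣ) : ℂ)) = if σ then -Complex.I else Complex.I := by
        intro σ
        cases σ
        · rw [D0.galAct_false]; rfl
        · rw [D0.galAct_true, Units.coe_star, ← starRingEnd_apply]
          show (starRingEnd ℂ) Complex.I = _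
          rw [Complex.conj_I]; rfl
      -- choose the twist by the sign of Im r
      obtain ⟨σ, hre⟩ : ∃ σ : Bool,
          0 < ((((D0.galAct σ Iu)⁻¹ * C0.scalar γ0 * (z₁ : ℂˣ) ^ (C0.degFr γ0 : ℕ) : ℂˣ) : ℂ)).re := by
        by_cases hlt : r.im < 0
        · refine ⟨true, ?_⟩
          rw [hprod, hval, Complex.re_ofReal_mul, if_pos rfl]
          refine mul_pos hcpos ?_
          rw [inv_neg, Complex.inv_I, neg_neg, Complex.mul_re, Complex.I_re, Complex.I_im, zero_mul,
            one_mul, zero_sub]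
          linarith
        · refine ⟨false, ?_⟩
          rw [hprod, hval, Complex.re_ofReal_mul, if_neg Bool.false_ne_true]
          refine mul_pos hcpos ?_
          rw [Complex.inv_I, neg_mul, Complex.neg_re, Complex.mul_re, Complex.I_re, Complex.I_im,
            zero_mul, one_mul, zero_sub, neg_neg]
          exact lt_of_le_of_ne (not_lt.mp hlt) (Ne.symm hz₁i)
      obtain ⟨RV, hRV, δ₁0, δ₂0, hb₁, hb₂, hI₁, hI₂, hcomp⟩ :=
        C0.exists_lift_pair_deg hRW γ0 hγI hRX hRXd hRXt φ0 rfl rfl σ hz₁ hre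
      let V : A (𝟭 D0) := ⟨⟨⟨D0.complex, RV, hRV⟩, D0.complex, Iso.refl _⟩⟩
      have hb₁' : (PreFrobenioid.baseFunctor C0.toElem).map δ₁0 = D0.Hom.gal σ := hb₁
      have hb₂' : (PreFrobenioid.baseFunctor C0.toElem).map δ₂0 = 𝟙 D0.complex := hb₂
      have w₁ : (PreFrobenioid.baseFunctor C0.toElem).map δ₁0 ≫ X.obj.iso.hom =
          V.obj.iso.hom ≫ (𝟭 D0).map (D0.Hom.gal σ) := by
        rw [hb₁']
        show D0.Hom.gal σ ≫ 𝟙 D0.complex = 𝟙 D0.complex ≫ D0.Hom.gal σ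
        rw [Category.comp_id, Category.id_comp]
      have w₂ : (PreFrobenioid.baseFunctor C0.toElem).map δ₂0 ≫ ιW.hom =
          V.obj.iso.hom ≫ (𝟭 D0).map ιW.hom := by
        rw [hb₂']
        rfl
      let δ₁C : V.obj ⟶ X.obj := ⟨δ₁0, D0.Hom.gal σ, w₁⟩
      let δ₂C : V.obj ⟶ ⟨⟨D0.complex, RW, hRW⟩, WD, ιW⟩ := ⟨δ₂0, ιW.hom, w₂⟩
      have hδ₁iso : PreFrobenioid.isometricMorphisms (C.toElem (𝟭 D0)) δ₁C := hI₁
      have hδ₂iso : PreFrobenioid.isometricMorphisms (C.toElem (𝟭 D0)) δ₂C := hI₂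
      refine ⟨V, ⟨δ₁C, hδ₁iso⟩, ⟨δ₂C, hδ₂iso⟩, ?_⟩
      apply WideSubcategory.hom_ext _
      exact CFP.hom_ext hcomp (hsub _ _ _)
  -- the projection of φ to D₀ is `Spec ℂ → Spec ℝ`, which is not a monomorphism
  exact D0.not_mono_toRealHom (hIII φ ⟨hfs, hmono⟩).2

end ArchFrd

end

end Literature.AlgebraicGeometry.Frobenioids
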